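import Mathlib.Data.Finsupp.Encodable
import Literature.NumberTheory.Transcendental.PseudoExpSEACStrong
import Literature.NumberTheory.Transcendental.PseudoExpChainAxioms
import HarnessLib

/-!
# A countable pseudo-exponential field: the ω-chain with the SEAC tasks (Zilber 2005 §§3–5;
Kirby 2013 FPEF §§2–3, §6; Bays–Kirby 2018 Thm 5.9)

We run the ω-chain of `PseudoExpChain.lean` inside the countable ambient field `Ω ⊆ ℂ` with a
fourth kind of task: for every code `(n, G, P)` — finitely many polynomials `G ⊆ Ω[X̄, Ȳ]` and a
finite parameter set `P ⊆ Ω` — the step `PState.stepSEAC G P` of `PseudoExpSEACStep.lean`, which,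
when `W = Z(G)` is irreducible, meets the torus, is rotund, additively and multiplicatively free of
dimension `n`, adjoins the additive coordinates of a generic point of `W` over
`k₁ = acl(s ∪ exp s ∪ P ∪ coeffs G)` with the prescribed exponentials. Since every task occurs,
the resulting total exponential `exp = cexp ∘ Λ∞` on `Ω` is:

* kernel-standard (`expKernel₂_eq`: every step is kernel-preserving — `PState.kInv_stepSEAC` by
  multiplicative freeness, Kirby 2013 Lemma 3.3),
* strong over `SK = ℚ · 2πi`, i.e. it has the Schanuel property (`schanuelProperty₂`: every step is
  a strong extension — `PState.predim_nonneg_stepSEAC` by rotundity, Bays–Kirby Prop. 7.3),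
* onto `Ωˣ`, infinite-dimensional for `ecl` (as in `PseudoExpChainAxioms.lean`), and
* **strongly exponentially-algebraically closed** (`isStronglyExpAlgClosed₂`): given `V = W ∩ 𝔾ⁿ`
  and finite `A, F₀`, the task `(n, G, A ∪ F₀)` with `Z(G) = W` fires at some stage and produces
  `(x̄, exp x̄) ∈ V` generic over `k₁ ⊇ ℚ(A ∪ F₀)`; likewise Kirby's linear-independence scheme over
  `k₁` (`axiomFourScheme₂`).

Assembled: `PseudoExpChain.exists_countable_pseudoExpField` — a countable algebraically closed
exponential field with standard kernel `ℤ · τ`, `ℚτ` strong (Schanuel property), surjective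
exponential, SEAC, the axiom-4 scheme over `ℚτ`, and infinite `ecl`-dimension. This is the
countable model of Zilber's axioms (Zilber 2005, §5; Kirby 2013, Thm 6.2 and Def. 6.3: the strong
exponential-algebraic closure of `SK^{ELA}`, built along an enumeration of the triples `(n, V, A)`), the input of the
quasiminimal-excellence machinery towards `exists_isZilberField_of_aleph0_lt`.

The exponential ring structure `expRing₂ A` is a definition, not an instance (the ELA-chain of
`PseudoExpChain.lean` already equips `Ω` with one); statements about it are phrased with
`letI := expRing₂ A`.

## References

* B. Zilber, *Pseudo-exponentiation on algebraically closed fields of characteristic zero*,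
  Ann. Pure Appl. Logic 132 (2005) 67–95, §§3–5.
* J. Kirby, *Finitely presented exponential fields*, Algebra & Number Theory 7 (2013) 943–980:
  Constructions 2.6, 2.11, 2.13, Lemma 2.14, §3 (Def. 3.1–3.2, Lemma 3.3), §6.
* M. Bays, J. Kirby, *Pseudo-exponential maps, variants, and quasiminimality*, Algebra & Number
  Theory 12 (2018): Thm 5.9, Prop. 7.3, Lemma 8.3.
-/

noncomputable section

open Set Complex

namespace Literature.NumberTheory.Transcendental

namespace PseudoExpChain

open GammaField Matroid Literature.ModelTheory.ExponentialFields
  Literature.ModelTheory.ExponentialFields.ExponentialRing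

variable {A : AmbientData}

/-! ### One ELA step, for an arbitrary total exponential extending the partial one -/

namespace PState

section StepFacts

variable [instE : Literature.ModelTheory.ExponentialFields.ExponentialRing A.Ω]

/-- The closure of `gens D ∪ T` in the algebraic matroid of `Ω` consists of elements algebraic (in
`ℂ`) over `genℂ σ ∪ T`, for any total exponential which is `cexp ∘ Λ` on `D`. [folklore] -/
theorem closure_union_gens_subset_state {σ : PState A} (h : σ.Inv)
    (hexp : ∀ e ∈ σ.D, ((ExponentialRing.exp e : A.Ω) : ℂ) = σ.E e) (T : Set A.Ω) :
    ∀ y ∈ (algMatroid A.Ω).closure (T ∪ gens σ.D), (y : ℂ) ∈ acl (σ.genℂ ∪ ((↑) : A.Ω → ℂ) '' T) := by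
  intro y hy
  change y ∈ acl (T ∪ gens σ.D) at hy
  rw [PseudoExpAmbient.acl_eq_preimage, mem_preimage] at hy
  refine acl_subset_acl_of_subset ?_ hy
  rintro _ ⟨z, hz, rfl⟩
  rcases hz with hzT | hzD | ⟨x, hxD, rfl⟩
  · exact subset_acl _ (Or.inr ⟨z, hzT, rfl⟩)
  · exact acl_mono subset_union_left (σ.coe_mem_acl_genℂ hzD)
  · rw [hexp x hxD]
    exact acl_mono subset_union_left (PState.E_mem_acl_genℂ h hxD)

/-- Compatibility of the total exponential with a state descends along `≼`. [folklore] -/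
theorem hexp_of_le {σ σ' : PState A} (hle : σ.LE σ') (hσ : σ.Good) (hσ' : σ'.Good)
    (hexp : ∀ e ∈ σ'.D, ((ExponentialRing.exp e : A.Ω) : ℂ) = σ'.E e) :
    ∀ e ∈ σ.D, ((ExponentialRing.exp e : A.Ω) : ℂ) = σ.E e := fun e he => by
  rw [hexp e (hle.D_le he), hle.E_eq hσ hσ' he]

/-- **Description of one ELA step** (exponential, logarithm or generic task): either the domain does
not change, or exactly one new basis vector `a ∉ D` is adjoined and `{a, exp a}` has relative rank
`≥ 1` over the old Γ-field. [cite: Kirby2013FPEF, Lemma 2.14 (proof)] -/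
theorem step_D {σ : PState A} (h : σ.Inv) (t : Task A)
    (hexp : ∀ e ∈ (step t σ).D, ((ExponentialRing.exp e : A.Ω) : ℂ) = (step t σ).E e) :
    (step t σ).D = σ.D ∨
      ∃ a : A.Ω, a ∉ σ.D ∧ (step t σ).D = σ.D ⊔ Submodule.span ℚ {a} ∧
        1 ≤ (algMatroid A.Ω).relRank (gens σ.D) {a, ExponentialRing.exp a} := by
  classical
  have hexpσ := hexp_of_le (le_step σ t) h.good (inv_step h t).good hexp
  have hcl : ∀ (T : Set A.Ω), ∀ y ∈ (algMatroid A.Ω).closure (T ∪ gens σ.D),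
      (y : ℂ) ∈ acl (σ.genℂ ∪ ((↑) : A.Ω → ℂ) '' T) := closure_union_gens_subset_state h hexpσ
  rcases t with a | b | j
  · -- exponential step
    have hc : step (Sum.inl a) σ = σ.stepExp a := rfl
    rw [hc] at hexp ⊢
    unfold PState.stepExp at hexp ⊢
    split_ifs at hexp ⊢ with ha
    · left; rfl
    · right
      set t := A.fresh (σ.genℂ ∪ {(a : ℂ)}) (σ.genℂ_finite.union (finite_singleton _)) with ht
      have ht0 : (t : ℂ) ≠ 0 := A.fresh_ne_zero _ _
      have haD' : a ∈ (σ.adjoin a (Complex.log t)).D := by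
        rw [PState.adjoin_D]; exact Submodule.mem_sup_right (Submodule.mem_span_singleton_self a)
      have hexpa : (ExponentialRing.exp a : A.Ω) = t := by
        apply Subtype.ext
        rw [hexp a haD', PState.E_of_mem (h.adjoin ha
          (by rw [Complex.exp_log ht0]; exact t.2)).good (by simp), PState.adjoin_w_self,
          Complex.exp_log ht0]
      refine ⟨a, ha, by rw [PState.adjoin_D], ?_⟩
      rw [hexpa, pair_comm]
      have htcl : (t : A.Ω) ∉ (algMatroid A.Ω).closure ({a} ∪ gens σ.D) := fun hmem =>
        A.fresh_notMem _ _ (by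
          have := hcl {a} t hmem
          rwa [image_singleton] at this)
      rw [(algMatroid A.Ω).relRank_insert_eq_add_one (mem_univ _) htcl]
      exact le_add_self
  · -- logarithm step
    have hc : step (Sum.inr (Sum.inl b)) σ = σ.stepLog b := rfl
    rw [hc] at hexp ⊢
    unfold PState.stepLog at hexp ⊢
    split_ifs at hexp ⊢ with hb
    · left; rfl
    · right
      push Not at hb
      set a := A.fresh (σ.genℂ ∪ {(b : ℂ)}) (σ.genℂ_finite.union (finite_singleton _)) with ha
      have haD : a ∉ σ.D := σ.fresh_notMem_D _ subset_union_left
      refine ⟨a, haD, by rw [PState.adjoin_D], ?_⟩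
      have hacl : (a : A.Ω) ∉ (algMatroid A.Ω).closure (gens σ.D) := fun hmem =>
        A.fresh_notMem _ _ (acl_mono subset_union_left (by
          have := hcl ∅ a (by rwa [empty_union])
          rwa [image_empty, union_empty] at this))
      calc (1 : ℕ∞) = (algMatroid A.Ω).relRank (gens σ.D) {a} := by
            rw [← insert_empty_eq a, (algMatroid A.Ω).relRank_insert_eq_add_one (mem_univ _)
              (by rwa [empty_union]), relRank_empty, zero_add]
        _ ≤ (algMatroid A.Ω).relRank (gens σ.D) {a, ExponentialRing.exp a} :=
            (algMatroid A.Ω).relRank_mono_right _ (singleton_subset_iff.2 (mem_insert _ _))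
  · -- generic step
    have hc : step (Sum.inr (Sum.inr j)) σ = σ.stepGen := rfl
    rw [hc] at hexp ⊢
    unfold PState.stepGen at hexp ⊢
    right
    set a := A.fresh σ.genℂ σ.genℂ_finite with ha
    have haD : a ∉ σ.D := σ.fresh_notMem_D _ le_rfl
    refine ⟨a, haD, by rw [PState.adjoin_D], ?_⟩
    have hacl : (a : A.Ω) ∉ (algMatroid A.Ω).closure (gens σ.D) := fun hmem =>
      A.fresh_notMem _ _ (by
        have := hcl ∅ a (by rwa [empty_union])
        rwa [image_empty, union_empty] at this)
    calc (1 : ℕ∞) = (algMatroid A.Ω).relRank (gens σ.D) {a} := by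
          rw [← insert_empty_eq a, (algMatroid A.Ω).relRank_insert_eq_add_one (mem_univ _)
            (by rwa [empty_union]), relRank_empty, zero_add]
      _ ≤ (algMatroid A.Ω).relRank (gens σ.D) {a, ExponentialRing.exp a} :=
          (algMatroid A.Ω).relRank_mono_right _ (singleton_subset_iff.2 (mem_insert _ _))

/-- **The generic step has predimension exactly one**: `D' = D + ℚa` with `a ∉ D` and
`{a, exp a}` of relative rank `2` over the old Γ-field. [cite: Kirby2013FPEF, Construction 2.6] -/
theorem stepGen_D {σ : PState A} (h : σ.Inv)
    (hexp : ∀ e ∈ σ.stepGen.D, ((ExponentialRing.exp e : A.Ω) : ℂ) = σ.stepGen.E e) :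
    ∃ a : A.Ω, a ∉ σ.D ∧ σ.stepGen.D = σ.D ⊔ Submodule.span ℚ {a} ∧
      (algMatroid A.Ω).relRank (gens σ.D) {a, ExponentialRing.exp a} = 2 := by
  classical
  have hexpσ := hexp_of_le (le_stepGen σ) h.good h.stepGen.good hexp
  have hcl := closure_union_gens_subset_state h hexpσ
  unfold PState.stepGen at hexp ⊢
  set a := A.fresh σ.genℂ σ.genℂ_finite with ha
  set t := A.fresh (σ.genℂ ∪ {(a : ℂ)}) (σ.genℂ_finite.union (finite_singleton _)) with ht
  have ht0 : (t : ℂ) ≠ 0 := A.fresh_ne_zero _ _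
  have haD : a ∉ σ.D := σ.fresh_notMem_D _ le_rfl
  have haD' : a ∈ (σ.adjoin a (Complex.log t)).D := by
    rw [PState.adjoin_D]; exact Submodule.mem_sup_right (Submodule.mem_span_singleton_self a)
  have hexpa : (ExponentialRing.exp a : A.Ω) = t := by
    apply Subtype.ext
    rw [hexp a haD', PState.E_of_mem (h.adjoin haD
      (by rw [Complex.exp_log ht0]; exact t.2)).good (by simp), PState.adjoin_w_self,
      Complex.exp_log ht0]
  refine ⟨a, haD, by rw [PState.adjoin_D], ?_⟩
  have hacl : (a : A.Ω) ∉ (algMatroid A.Ω).closure (gens σ.D) := fun hmem =>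
    A.fresh_notMem _ _ (by
      have := hcl ∅ a (by rwa [empty_union])
      rwa [image_empty, union_empty] at this)
  have htcl : (t : A.Ω) ∉ (algMatroid A.Ω).closure ({a} ∪ gens σ.D) := fun hmem =>
    A.fresh_notMem _ _ (by
      have := hcl {a} t hmem
      rwa [image_singleton] at this)
  rw [hexpa, pair_comm, (algMatroid A.Ω).relRank_insert_eq_add_one (mem_univ _) htcl,
    ← insert_empty_eq a, (algMatroid A.Ω).relRank_insert_eq_add_one (mem_univ _)
      (by rwa [empty_union]), relRank_empty, zero_add]
  rfl

/-- **Each ELA step is strong** (Kirby, Lemma 2.14): `δ(Y/D) ≥ 0` for `D ≤ Y ≤ D'`.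
[cite: Kirby2013FPEF, Lemma 2.14] -/
theorem predim_nonneg_step {σ : PState A} (h : σ.Inv) (t : Task A)
    (hexp : ∀ e ∈ (step t σ).D, ((ExponentialRing.exp e : A.Ω) : ℂ) = (step t σ).E e)
    {Y : Submodule ℚ A.Ω} (h₁ : σ.D ≤ Y) (h₂ : Y ≤ (step t σ).D) : 0 ≤ predim σ.D Y := by
  rcases step_D h t hexp with heq | ⟨a, haD, heq, hrk⟩
  · rw [heq] at h₂
    rw [le_antisymm h₂ h₁, predim_self]
  · rw [heq] at h₂
    rcases eq_or_eq_of_le_sup_span_singleton h₁ h₂ with rfl | rfl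
    · rw [predim_self]
    · rw [predim_sup_left, predim_def, ldim_span_singleton_of_not_mem haD, td_span_singleton]
      have hfin : (algMatroid A.Ω).relRank (gens σ.D) {a, ExponentialRing.exp a} ≠ ⊤ := by
        rw [← td_span_singleton]
        exact td_ne_top (isFG_span_of_finite _ (finite_singleton a))
      have h1 : 1 ≤ ((algMatroid A.Ω).relRank (gens σ.D) {a, ExponentialRing.exp a}).toNat := by
        rw [← ENat.coe_toNat hfin] at hrk
        exact_mod_cast hrk
      omega

end StepFacts

/-- **The generic point's additive coordinates are linearly independent over `k₁`** (not only over
`D`): a relation `∑ mᵢ xᵢ = c ∈ k₁` is a linear polynomial over `k₁` vanishing at the generic point,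
hence on `W`, contradicting additive freeness. [cite: Kirby2013FPEF, §3 (additively free)] -/
theorem genPt_linIndep_k₁ (σ : PState A) (h : σ.Inv) {n : ℕ}
    (G : Finset (MvPolynomial (Fin n ⊕ Fin n) A.Ω)) (P : Finset A.Ω)
    (hW : IsIrreducibleClosed A.Ω (W G)) (hadd : IsAddFree A.Ω n (W G ∩ torusLocus A.Ω n))
    (m : Fin n → ℤ) (hm : (∑ i, (m i : A.Ω) * σ.genPt h G P hW (Sum.inl i)) ∈ σ.k₁ h G P) :
    m = 0 := by
  classical
  by_contra hm0
  set c : A.Ω := ∑ i, (m i : A.Ω) * σ.genPt h G P hW (Sum.inl i) with hc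
  set p : MvPolynomial (Fin n ⊕ Fin n) (σ.k₁ h G P) :=
    ∑ i, MvPolynomial.C ((m i : ℤ) : σ.k₁ h G P) * MvPolynomial.X (Sum.inl i) -
      MvPolynomial.C ⟨c, hm⟩ with hp
  have hpeval : ∀ w : Fin n ⊕ Fin n → A.Ω,
      MvPolynomial.aeval w p = ∑ i, (m i : A.Ω) * w (Sum.inl i) - c := by
    intro w
    simp only [hp, map_sub, map_sum, map_mul, MvPolynomial.aeval_C, MvPolynomial.aeval_X,
      map_intCast]
    rfl
  have hpz : MvPolynomial.aeval (σ.genPt h G P hW) p = 0 := by rw [hpeval, hc, sub_self]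
  refine hadd m hm0 ⟨c, fun w hw => ?_⟩
  have := σ.forall_W_of_aeval_genPt h G P hW hpz w hw.1
  rwa [hpeval, sub_eq_zero] at this

end PState

/-! ### Codes, tasks and the chain -/

/-- Codes of SEAC tasks: `(n, G, P)` with `G` finitely many polynomials in `2n` variables over `Ω`
(cutting out `W = Z(G)`) and `P` a finite parameter set. [folklore] -/
abbrev Code (A : AmbientData) : Type :=
  Σ n : ℕ, Finset (MvPolynomial (Fin n ⊕ Fin n) A.Ω) × Finset A.Ω

/-- Polynomial rings in finitely many variables over the countable field `Ω` are countable.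
[folklore] -/
instance instCountableMvPolynomial (n : ℕ) : Countable (MvPolynomial (Fin n ⊕ Fin n) A.Ω) :=
  (AddMonoidAlgebra.coeff_injective :
    Function.Injective (AddMonoidAlgebra.coeff : MvPolynomial (Fin n ⊕ Fin n) A.Ω → _)).countable

/-- The tasks of the SEAC chain: the ELA tasks of `PseudoExpChain.lean` and the codes. [folklore] -/
abbrev Task₂ (A : AmbientData) : Type := Task A ⊕ Code A

/-- A fixed enumeration of all tasks. [folklore] -/
def task₂ (A : AmbientData) : ℕ → Task₂ A :=
  Classical.choose (exists_surjective_nat (Task₂ A))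

/-- Every task occurs in the enumeration. [folklore] -/
theorem task₂_surjective (A : AmbientData) : Function.Surjective (task₂ A) :=
  Classical.choose_spec (exists_surjective_nat (Task₂ A))

/-- One step of the SEAC chain, according to the task. [folklore] -/
def step₂ (t : Task₂ A) (σ : PState A) : PState A :=
  Sum.elim (fun t => step t σ) (fun c => PState.stepSEAC c.2.1 c.2.2 σ) t

variable (A) in
/-- **The ω-chain with SEAC tasks** `SK = σ₀ ≼ σ₁ ≼ ⋯`. [cite: Kirby2013FPEF, Thm 6.2 (proof: the chain of simple
ELA-extensions determined by the triples (n, V, A))] [cite: Zilber2005PseudoExp, §5] -/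
def chain₂ : ℕ → PState A
  | 0 => init A
  | k + 1 => step₂ (task₂ A k) (chain₂ k)

/-- Unfolding the successor stage. [folklore] -/
theorem chain₂_succ (k : ℕ) : chain₂ A (k + 1) = step₂ (task₂ A k) (chain₂ A k) := rfl

/-- Each step preserves the invariant. [folklore] -/
theorem inv_step₂ {σ : PState A} (h : σ.Inv) (t : Task₂ A) : (step₂ t σ).Inv := by
  rcases t with t | c
  · exact inv_step h t
  · exact h.stepSEAC

/-- Each step extends the state. [folklore] -/
theorem le_step₂ (σ : PState A) (t : Task₂ A) : σ.LE (step₂ t σ) := by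
  rcases t with t | c
  · exact le_step σ t
  · exact PState.le_stepSEAC σ

/-- Each step is kernel-preserving. [cite: Kirby2013FPEF, §2 and Lemma 3.3] -/
theorem kInv_step₂ {σ : PState A} (hK : ∀ x ∈ σ.D, σ.E x = 1 → ∃ n : ℤ, x = n • A.τ) (h : σ.Inv)
    (t : Task₂ A) : ∀ x ∈ (step₂ t σ).D, (step₂ t σ).E x = 1 → ∃ n : ℤ, x = n • A.τ := by
  rcases t with (a | b | j) | c
  · exact PState.kInv_stepExp hK h a
  · exact PState.kInv_stepLog hK h b
  · exact PState.kInv_stepGen hK h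
  · exact PState.kInv_stepSEAC hK h

/-- **The invariant holds along the chain.** [folklore] -/
theorem inv_chain₂ : ∀ k, (chain₂ A k).Inv
  | 0 => inv_init
  | k + 1 => inv_step₂ (inv_chain₂ k) _

/-- The stages are good. [folklore] -/
theorem good_chain₂ (k : ℕ) : (chain₂ A k).Good := (inv_chain₂ k).good

/-- The chain is increasing. [folklore] -/
theorem chain₂_le_succ (k : ℕ) : (chain₂ A k).LE (chain₂ A (k + 1)) := le_step₂ _ _

/-- The chain is increasing (transitive closure). [folklore] -/
theorem chain₂_mono {k l : ℕ} (h : k ≤ l) : (chain₂ A k).LE (chain₂ A l) := by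
  induction h with
  | refl => exact PState.LE.refl _
  | step _ ih => exact ih.trans (chain₂_le_succ _)

/-- The domains increase along the chain. [folklore] -/
theorem D₂_mono {k l : ℕ} (h : k ≤ l) : (chain₂ A k).D ≤ (chain₂ A l).D := (chain₂_mono h).D_le

/-- Along the chain the partial exponentials are compatible. [folklore] -/
theorem E_chain₂_eq {k l : ℕ} (h : k ≤ l) {x : A.Ω} (hx : x ∈ (chain₂ A k).D) :
    (chain₂ A l).E x = (chain₂ A k).E x :=
  (chain₂_mono h).E_eq (good_chain₂ k) (good_chain₂ l) hx

/-- `τ` is in every domain. [folklore] -/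
theorem τ_mem_D₂ (k : ℕ) : A.τ ∈ (chain₂ A k).D := (chain₂ A k).subset_D (inv_chain₂ k).τ_mem

/-- **The kernel invariant holds along the chain.** [cite: Kirby2013FPEF, §2 and Lemma 3.3] -/
theorem kInv_chain₂ : ∀ k, ∀ x ∈ (chain₂ A k).D, (chain₂ A k).E x = 1 → ∃ n : ℤ, x = n • A.τ
  | 0 => PState.kInv_init
  | k + 1 => kInv_step₂ (kInv_chain₂ k) (inv_chain₂ k) _

/-- **Every element of `Ω` is eventually in the domain** (its exponential task occurs).
[cite: Kirby2013FPEF, Construction 2.7] -/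
theorem exists_mem_D₂ (a : A.Ω) : ∃ k, a ∈ (chain₂ A k).D := by
  classical
  obtain ⟨k, hk⟩ := task₂_surjective A (Sum.inl (Sum.inl a))
  refine ⟨k + 1, ?_⟩
  rw [chain₂_succ, hk]
  change a ∈ ((chain₂ A k).stepExp a).D
  unfold PState.stepExp
  split_ifs with ha
  · exact ha
  · rw [PState.adjoin_D]
    exact Submodule.mem_sup_right (Submodule.mem_span_singleton_self a)

/-! ### The total exponential -/

/-- The first stage at which `a` is in the domain. [folklore] -/
def stage₂ (a : A.Ω) : ℕ := by
  classical
  exact Nat.find (exists_mem_D₂ a)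

/-- `a` lies in the domain at its stage. [folklore] -/
theorem mem_D_stage₂ (a : A.Ω) : a ∈ (chain₂ A (stage₂ a)).D := by
  classical
  exact Nat.find_spec (exists_mem_D₂ a)

/-- **The total exponential as a complex number.** [cite: Kirby2013FPEF, Construction 2.13] -/
def Einf₂ (a : A.Ω) : ℂ := (chain₂ A (stage₂ a)).E a

/-- `Einf₂` is computed in any stage whose domain contains the element. [folklore] -/
theorem Einf₂_eq {k : ℕ} {a : A.Ω} (ha : a ∈ (chain₂ A k).D) : Einf₂ a = (chain₂ A k).E a := by
  rw [Einf₂]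
  rcases le_total (stage₂ a) k with h | h
  · exact (E_chain₂_eq h (mem_D_stage₂ a)).symm
  · exact E_chain₂_eq h ha

/-- `Einf₂` is a homomorphism. [folklore] -/
theorem Einf₂_add (a b : A.Ω) : Einf₂ (a + b) = Einf₂ a * Einf₂ b := by
  obtain ⟨k, hk⟩ := exists_mem_D₂ a
  obtain ⟨l, hl⟩ := exists_mem_D₂ b
  have ha : a ∈ (chain₂ A (max k l)).D := D₂_mono (le_max_left k l) hk
  have hb : b ∈ (chain₂ A (max k l)).D := D₂_mono (le_max_right k l) hl
  rw [Einf₂_eq (Submodule.add_mem _ ha hb), Einf₂_eq ha, Einf₂_eq hb, PState.E_add]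

/-- `Einf₂ 0 = 1`. [folklore] -/
theorem Einf₂_zero : Einf₂ (0 : A.Ω) = 1 := by
  rw [Einf₂_eq (Submodule.zero_mem (chain₂ A 0).D), PState.E_zero]

/-- `Einf₂` takes values in `Ω`. [folklore] -/
theorem Einf₂_mem (a : A.Ω) : Einf₂ a ∈ A.Ω :=
  E_mem_Ω (inv_chain₂ _) (mem_D_stage₂ a)

/-- **The kernel of `Einf₂` is `ℤ · 2πi`.** [cite: Kirby2013FPEF, Construction 2.11, §2 and Lemma 3.3] -/
theorem Einf₂_eq_one_iff (x : A.Ω) : Einf₂ x = 1 ↔ ∃ n : ℤ, x = n • A.τ := by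
  constructor
  · intro h
    obtain ⟨k, hk⟩ := exists_mem_D₂ x
    rw [Einf₂_eq hk] at h
    exact kInv_chain₂ k x hk h
  · rintro ⟨n, rfl⟩
    have hmem : (n : ℚ) • A.τ ∈ (chain₂ A 0).D := Submodule.smul_mem _ _ (τ_mem_D₂ 0)
    have hcast : (n • A.τ : A.Ω) = (n : ℚ) • A.τ := (Int.cast_smul_eq_zsmul ℚ n A.τ).symm
    rw [hcast, Einf₂_eq hmem]
    show (init A).E ((n : ℚ) • A.τ) = 1
    rw [PState.E_smul_τ inv_init, Complex.exp_eq_one_iff]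
    exact ⟨n, by rw [Rat.smul_def]; push_cast; ring⟩

variable (A) in
/-- **The exponential ring structure of the SEAC chain on `Ω`**: `exp a = cexp (Λ∞ a)` (a
definition, used through `letI := expRing₂ A`). [cite: Kirby2013FPEF, Construction 2.13 and Thm 6.2] -/
@[reducible] def expRing₂ : Literature.ModelTheory.ExponentialFields.ExponentialRing A.Ω where
  exp a := ⟨Einf₂ a, Einf₂_mem a⟩
  exp_zero := Subtype.ext Einf₂_zero
  exp_add a b := Subtype.ext (Einf₂_add a b)

/-- The exponential as a complex number is `Einf₂`. [folklore] -/
theorem coe_exp₂ (a : A.Ω) :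
    letI := expRing₂ A; ((ExponentialRing.exp a : A.Ω) : ℂ) = Einf₂ a := rfl

/-- The exponential on a stage is the partial exponential of that stage. [folklore] -/
theorem coe_exp₂_eq_E {k : ℕ} {x : A.Ω} (hx : x ∈ (chain₂ A k).D) :
    letI := expRing₂ A; ((ExponentialRing.exp x : A.Ω) : ℂ) = (chain₂ A k).E x := by
  rw [coe_exp₂, Einf₂_eq hx]

/-- Compatibility of `exp` with the partial exponential of a stage, in the form consumed by the
step lemmas. [folklore] -/
theorem hexp_chain₂ (k : ℕ) :
    letI := expRing₂ A
    ∀ e ∈ (chain₂ A k).D, ((ExponentialRing.exp e : A.Ω) : ℂ) = (chain₂ A k).E e :=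
  fun _ he => coe_exp₂_eq_E he

/-! ### Strongness of the stages -/

/-- **Each step of the SEAC chain is strong**: the ELA steps by Kirby's Lemma 2.14, the SEAC steps
by rotundity (`PState.predim_nonneg_stepSEAC`). [cite: Kirby2013FPEF, Lemma 2.14]
[cite: BaysKirby2018ANT, Prop. 7.3] -/
theorem predim_step₂_nonneg (k : ℕ) {Y : Submodule ℚ A.Ω} (h₁ : (chain₂ A k).D ≤ Y)
    (h₂ : Y ≤ (chain₂ A (k + 1)).D) : letI := expRing₂ A; 0 ≤ predim (chain₂ A k).D Y := by
  letI := expRing₂ A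
  have hexp := hexp_chain₂ (A := A) (k + 1)
  rw [chain₂_succ] at hexp h₂
  rcases htk : task₂ A k with t | ⟨n, G, P⟩
  · rw [htk] at hexp h₂
    exact PState.predim_nonneg_step (inv_chain₂ k) t hexp h₁ h₂
  · rw [htk] at hexp h₂
    exact PState.predim_nonneg_stepSEAC' (inv_chain₂ k) hexp h₁ h₂

/-- Subspaces of a stage are finitely generated over any base. [folklore] -/
theorem isFG_of_le_D₂ (X : Submodule ℚ A.Ω) {Y : Submodule ℚ A.Ω} {l : ℕ}
    (h : Y ≤ (chain₂ A l).D) : IsFG X Y :=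
  (PState.fg_of_le_D_state _ h).map _

/-- **`δ(Y/Dₖ) ≥ 0` for `Dₖ ≤ Y ≤ D_l`** (composites of strong extensions are strong).
[cite: Kirby2013FPEF, Lemma 2.3] -/
theorem predim_nonneg_of_le_of_le₂ {k l : ℕ} (hkl : k ≤ l) {Y : Submodule ℚ A.Ω}
    (h₁ : (chain₂ A k).D ≤ Y) (h₂ : Y ≤ (chain₂ A l).D) :
    letI := expRing₂ A; 0 ≤ predim (chain₂ A k).D Y := by
  letI := expRing₂ A
  induction l, hkl using Nat.le_induction generalizing Y with
  | base => rw [le_antisymm h₂ h₁, predim_self]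
  | succ l hkl ih =>
    have h1' : (chain₂ A k).D ≤ Y ⊓ (chain₂ A l).D := le_inf h₁ (D₂_mono hkl)
    have hY' : 0 ≤ predim (chain₂ A k).D (Y ⊓ (chain₂ A l).D) := ih h1' inf_le_right
    have hadd : predim (chain₂ A k).D Y =
        predim (chain₂ A k).D (Y ⊓ (chain₂ A l).D) + predim (Y ⊓ (chain₂ A l).D) Y :=
      predim_add h1' inf_le_left (isFG_of_le_D₂ _ h₂)
    have hsub : predim (chain₂ A l).D (Y ⊔ (chain₂ A l).D) ≤ predim (Y ⊓ (chain₂ A l).D) Y :=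
      predim_sup_le Y (chain₂ A l).D (isFG_of_le_D₂ _ h₂)
    have hstep : 0 ≤ predim (chain₂ A l).D (Y ⊔ (chain₂ A l).D) :=
      predim_step₂_nonneg l le_sup_right (sup_le h₂ (D₂_mono (Nat.le_succ l)))
    linarith

/-- A finite set lies in some stage beyond any given one. [folklore] -/
theorem exists_subset_D₂ {P : Set A.Ω} (hP : P.Finite) (k : ℕ) :
    ∃ l, k ≤ l ∧ P ⊆ (chain₂ A l).D := by
  classical
  refine ⟨max k (hP.toFinset.sup stage₂), le_max_left _ _, fun p hp => ?_⟩
  have h1 : stage₂ p ≤ hP.toFinset.sup stage₂ := Finset.le_sup (hP.mem_toFinset.2 hp)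
  exact D₂_mono (h1.trans (le_max_right _ _)) (mem_D_stage₂ p)

/-- **Every stage is strong in `(Ω, exp)`.** [cite: Kirby2013FPEF, Lemma 2.3 and Thm 6.2 (proof)] -/
theorem isStrong_D_chain₂ (k : ℕ) : letI := expRing₂ A; IsStrong (chain₂ A k).D := by
  letI := expRing₂ A
  classical
  intro Y hle hfg
  obtain ⟨s, hsY, hYs⟩ := isFG_iff_exists_finset.1 hfg
  obtain ⟨l, hkl, hsl⟩ := exists_subset_D₂ (s.finite_toSet) k
  have hYl : Y ≤ (chain₂ A l).D :=
    hYs.trans (sup_le (D₂_mono hkl) (Submodule.span_le.2 hsl))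
  exact predim_nonneg_of_le_of_le₂ hkl hle hYl

/-! ### The axioms -/

/-- `exp τ = 1`. [folklore] -/
theorem exp₂_τ : letI := expRing₂ A; (ExponentialRing.exp A.τ : A.Ω) = 1 :=
  Subtype.ext (by rw [coe_exp₂]; exact (Einf₂_eq_one_iff A.τ).2 ⟨1, by simp⟩)

/-- **The kernel is `τℤ`.** [cite: Kirby2013FPEF, Construction 2.11, §2 and Lemma 3.3] -/
theorem expKernel₂_eq : letI := expRing₂ A; expKernel A.Ω = AddSubgroup.zmultiples A.τ := by
  letI := expRing₂ A
  ext x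
  rw [mem_expKernel_iff, AddSubgroup.mem_zmultiples_iff]
  constructor
  · intro h
    have h' : Einf₂ x = 1 := by
      have := congrArg Subtype.val h
      rwa [coe_exp₂] at this
    obtain ⟨n, rfl⟩ := (Einf₂_eq_one_iff x).1 h'
    exact ⟨n, rfl⟩
  · rintro ⟨n, rfl⟩
    exact Subtype.ext (by rw [coe_exp₂]; exact (Einf₂_eq_one_iff _).2 ⟨n, rfl⟩)

/-- **Standard kernel.** [cite: Kirby2013FPEF, Construction 2.11] -/
theorem hasStandardKernel₂ : letI := expRing₂ A; HasStandardKernel A.Ω := by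
  letI := expRing₂ A
  exact ⟨A.τ, transcendental_τ, expKernel₂_eq⟩

/-- **`SK ◁ (Ω, exp)`**: the base `ℚ · 2πi` is strong. [cite: Kirby2013FPEF, Lemma 2.14 and Thm 6.2] -/
theorem isStrong_span_τ₂ : letI := expRing₂ A; IsStrong (Submodule.span ℚ ({A.τ} : Set A.Ω)) := by
  letI := expRing₂ A
  have : (chain₂ A 0).D = Submodule.span ℚ ({A.τ} : Set A.Ω) := by
    change Submodule.span ℚ ((({A.τ} : Finset A.Ω)) : Set A.Ω) = _
    rw [Finset.coe_singleton]
  rw [← this]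
  exact isStrong_D_chain₂ 0

/-- **The Schanuel property.** [cite: Kirby2013FPEF, Lemma 2.14] [cite: BaysKirby2018ANT, Thm 9.1 (proof)] -/
theorem schanuelProperty₂ : letI := expRing₂ A; SchanuelProperty A.Ω := by
  letI := expRing₂ A
  exact (schanuelProperty_iff_isStrong_span_kernelGenerator transcendental_τ exp₂_τ).2
    isStrong_span_τ₂

/-- **`exp` is onto `Ωˣ`.** [cite: Kirby2013FPEF, Construction 2.13] -/
theorem isSurjectiveOntoUnits₂ : letI := expRing₂ A; IsSurjectiveOntoUnits A.Ω := by
  letI := expRing₂ A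
  classical
  intro b hb
  obtain ⟨l, hl⟩ := task₂_surjective A (Sum.inl (Sum.inr (Sum.inl b)))
  have hc : chain₂ A (l + 1) = (chain₂ A l).stepLog b := by
    rw [chain₂_succ, hl]; rfl
  unfold PState.stepLog at hc
  split_ifs at hc with h
  · rcases h with h0 | ⟨x, hx, hEx⟩
    · exact (hb h0).elim
    · exact ⟨x, Subtype.ext (by rw [coe_exp₂_eq_E hx, hEx])⟩
  · push Not at h
    have hb0 : (b : ℂ) ≠ 0 := fun h0 => hb (Subtype.ext h0)
    set a := A.fresh ((chain₂ A l).genℂ ∪ {(b : ℂ)})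
      ((chain₂ A l).genℂ_finite.union (finite_singleton _)) with ha
    have haD : a ∉ (chain₂ A l).D := (chain₂ A l).fresh_notMem_D _ subset_union_left
    have haD' : a ∈ (chain₂ A (l + 1)).D := by
      rw [hc, PState.adjoin_D]; exact Submodule.mem_sup_right (Submodule.mem_span_singleton_self a)
    refine ⟨a, Subtype.ext ?_⟩
    rw [coe_exp₂_eq_E haD', hc, PState.E_of_mem ((inv_chain₂ l).adjoin haD
      (by rw [Complex.exp_log hb0]; exact b.2)).good (by simp), PState.adjoin_w_self,
      Complex.exp_log hb0]

/-- Generic tasks occur beyond any stage. [folklore] -/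
theorem exists_gen_task₂_ge (k : ℕ) :
    ∃ l, k ≤ l ∧ ∃ j, task₂ A l = Sum.inl (Sum.inr (Sum.inr j)) := by
  classical
  have hex : ∀ j : ℕ, ∃ l, task₂ A l = Sum.inl (Sum.inr (Sum.inr j)) := fun j =>
    task₂_surjective A _
  choose f hf using hex
  have hinj : Function.Injective f := fun i j hij => by
    have := (hf i).symm.trans ((congrArg (task₂ A) hij).trans (hf j))
    simpa using this
  by_contra hcon
  push Not at hcon
  have hlt : ∀ j, f j < k := fun j => by
    by_contra hge
    exact hcon (f j) (not_lt.1 hge) j (hf j)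
  have hfin : Set.Finite (Set.range f) :=
    (Set.finite_Iio k).subset (by rintro _ ⟨j, rfl⟩; exact hlt j)
  exact (Set.infinite_range_of_injective hinj) hfin

/-- The generic step at stage `l`: `D_{l+1} = D_l + ℚa`, `a ∉ D_l`, `{a, exp a}` of relative rank `2`.
[cite: Kirby2013FPEF, Construction 2.6] -/
theorem chain₂_succ_D_of_gen {l : ℕ} {j : ℕ} (htk : task₂ A l = Sum.inl (Sum.inr (Sum.inr j))) :
    letI := expRing₂ A
    ∃ a : A.Ω, a ∉ (chain₂ A l).D ∧ (chain₂ A (l + 1)).D = (chain₂ A l).D ⊔ Submodule.span ℚ {a} ∧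
      (algMatroid A.Ω).relRank (gens (chain₂ A l).D) {a, ExponentialRing.exp a} = 2 := by
  letI := expRing₂ A
  have hexp := hexp_chain₂ (A := A) (l + 1)
  have hc : chain₂ A (l + 1) = (chain₂ A l).stepGen := by rw [chain₂_succ, htk]; rfl
  rw [hc] at hexp ⊢
  exact PState.stepGen_D (inv_chain₂ l) hexp

/-- **Infinite dimension**: no finite subset is `ecl`-spanning. [cite: Kirby2010EAEF, Thm 1.3]
[cite: Kirby2013FPEF, Lemma 2.14] -/
theorem ecl_ne_univ₂ (P : Set A.Ω) (hP : P.Finite) : letI := expRing₂ A; ecl P ≠ Set.univ := by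
  letI := expRing₂ A
  classical
  obtain ⟨k, -, hk⟩ := exists_subset_D₂ hP 0
  obtain ⟨l, hkl, j, htk⟩ := exists_gen_task₂_ge (A := A) k
  obtain ⟨a, haD, hD, hrk⟩ := chain₂_succ_D_of_gen htk
  intro huniv
  have ha : a ∈ ecl (((chain₂ A l).D : Submodule ℚ A.Ω) : Set A.Ω) := by
    refine ecl_mono (hk.trans ?_) (by rw [huniv]; exact mem_univ a)
    exact D₂_mono hkl
  obtain ⟨n, x, hax, hδ⟩ := exists_predim_le_zero_of_mem_ecl_coe (chain₂ A l).D ha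
  set Y : Submodule ℚ A.Ω := (chain₂ A l).D ⊔ Submodule.span ℚ (range x) with hY
  have h1 : predim (chain₂ A l).D Y ≤ 0 := by rw [hY, predim_sup_left]; exact hδ
  have hle : (chain₂ A (l + 1)).D ≤ Y := by
    rw [hD]
    refine sup_le le_sup_left ?_
    rw [Submodule.span_singleton_le_iff_mem]
    exact Submodule.mem_sup_right (Submodule.subset_span hax)
  have hfgl : IsFG (chain₂ A l).D Y :=
    isFG_sup_left.2 (isFG_span_of_finite _ (finite_range x))
  have h2 : predim (chain₂ A l).D Y =
      predim (chain₂ A l).D (chain₂ A (l + 1)).D + predim (chain₂ A (l + 1)).D Y :=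
    predim_add (D₂_mono (Nat.le_succ l)) hle hfgl
  have h3 : predim (chain₂ A l).D (chain₂ A (l + 1)).D = 1 := by
    rw [hD, predim_sup_left, predim_def, ldim_span_singleton_of_not_mem haD, td_span_singleton, hrk]
    rfl
  have h4 : 0 ≤ predim (chain₂ A (l + 1)).D Y :=
    isStrong_D_chain₂ (l + 1) hle (hfgl.of_le_left (D₂_mono (Nat.le_succ l)))
  linarith

/-- Infinite dimension, pointwise form. [folklore] -/
theorem exists_notMem_ecl₂ (C : Set A.Ω) (hC : C.Finite) : letI := expRing₂ A; ∃ d, d ∉ ecl C := by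
  letI := expRing₂ A
  by_contra h
  push Not at h
  exact ecl_ne_univ₂ C hC (eq_univ_of_forall h)

/-! ### Strong exponential-algebraic closedness -/

/-- Every Zariski closed subset of `Ω^{2n}` is cut out by finitely many polynomials (Hilbert's
basis theorem). [folklore] -/
theorem exists_finset_W_eq {n : ℕ} {W : Set (Fin n ⊕ Fin n → A.Ω)} (hW : IsZariskiClosed A.Ω W) :
    ∃ G : Finset (MvPolynomial (Fin n ⊕ Fin n) A.Ω), PState.W G = W := by
  obtain ⟨I, hI⟩ := hW
  obtain ⟨G, hG⟩ := (inferInstance : IsNoetherian (MvPolynomial (Fin n ⊕ Fin n) A.Ω)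
    (MvPolynomial (Fin n ⊕ Fin n) A.Ω)).noetherian I
  refine ⟨G, ?_⟩
  rw [PState.W, hI]
  exact congrArg _ hG

/-- **The SEAC task for `(n, G, P)` fires at the stage where it is enumerated**, producing a point
`z = (x̄, exp x̄)` of `W = Z(G)` which is generic over `k₁` and whose additive coordinates are
linearly independent over `k₁`. [cite: Zilber2005PseudoExp, §5] [cite: Kirby2013FPEF, Thm 6.2 (proof)] -/
theorem exists_generic_expPt {n : ℕ} (G : Finset (MvPolynomial (Fin n ⊕ Fin n) A.Ω))
    (P : Finset A.Ω) (hH : PState.Hyp G) :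
    letI := expRing₂ A
    ∃ (l : ℕ) (h : (chain₂ A l).Inv), (chain₂ A l).genPt h G P hH.irr ∈ PState.W G ∩ expGraph A.Ω n := by
  letI := expRing₂ A
  classical
  obtain ⟨l, hl⟩ := task₂_surjective A (Sum.inr ⟨n, G, P⟩)
  have hc : chain₂ A (l + 1) = PState.stepSEAC G P (chain₂ A l) := by rw [chain₂_succ, hl]; rfl
  refine ⟨l, inv_chain₂ l, (chain₂ A l).genPt_mem_W _ G P hH.irr, fun i => ?_⟩
  symm
  apply Subtype.ext
  have hmem : (chain₂ A l).genPt (inv_chain₂ l) G P hH.irr (Sum.inl i) ∈ (chain₂ A (l + 1)).D := by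
    rw [hc, PState.D_stepSEAC_of (inv_chain₂ l) hH]
    exact Submodule.mem_sup_right (Submodule.subset_span ⟨i, rfl⟩)
  rw [coe_exp₂_eq_E hmem, hc]
  exact PState.E_stepSEAC_x (P := P) (inv_chain₂ l) hH i

/-- Genericity over `k₁` descends to genericity over any subfield of `k₁`. [folklore] -/
theorem isGenericOver_of_le_k₁ {σ : PState A} (h : σ.Inv) {n : ℕ}
    {G : Finset (MvPolynomial (Fin n ⊕ Fin n) A.Ω)} {P : Finset A.Ω}
    (hW : IsIrreducibleClosed A.Ω (PState.W G)) {F' : Subfield A.Ω} (hle : F' ≤ σ.k₁ h G P) :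
    IsGenericOver F' (PState.W G) (σ.genPt h G P hW) := by
  refine ⟨σ.genPt_mem_W h G P hW, le_antisymm ?_ ?_⟩
  · intro p hp
    letI : Algebra F' (σ.k₁ h G P) := (Subfield.inclusion hle).toAlgebra
    haveI : IsScalarTower F' (σ.k₁ h G P) A.Ω := IsScalarTower.of_algebraMap_eq fun _ => rfl
    have hz : MvPolynomial.aeval (σ.genPt h G P hW)
        (MvPolynomial.map (algebraMap F' (σ.k₁ h G P)) p) = 0 := by
      rw [MvPolynomial.aeval_map_algebraMap]
      exact (MvPolynomial.mem_vanishingIdeal_singleton_iff _ p).1 hp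
    rw [MvPolynomial.mem_vanishingIdeal_iff]
    intro w hw
    have := σ.forall_W_of_aeval_genPt h G P hW hz w hw
    rwa [MvPolynomial.aeval_map_algebraMap] at this
  · exact MvPolynomial.vanishingIdeal_anti_mono (singleton_subset_iff.2 (σ.genPt_mem_W h G P hW))

/-- **`(Ω, exp)` is strongly exponentially-algebraically closed.** [cite: Zilber2005PseudoExp, §5 (Lemma 5.11 ff.)]
[cite: Kirby2013FPEF, Thm 6.2 (proof)] [cite: BaysKirby2018ANT, Thm 5.9] -/
theorem isStronglyExpAlgClosed₂ : letI := expRing₂ A; IsStronglyExpAlgClosed A.Ω := by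
  letI := expRing₂ A
  classical
  intro n W hirr hne hrot hadd hmul hdim A' F₀ _hdef
  obtain ⟨G, rfl⟩ := exists_finset_W_eq hirr.1
  have hH : PState.Hyp G := ⟨hirr, hne, hrot, hadd, hmul, hdim⟩
  obtain ⟨l, h, hz⟩ := exists_generic_expPt G (A' ∪ F₀) hH
  refine ⟨_, hz, isGenericOver_of_le_k₁ h hH.irr (Subfield.closure_le.2 ?_)⟩
  intro x hx
  refine (chain₂ A l).S₀_subset_k₁ h G (A' ∪ F₀) ?_
  simp only [PState.S₀, Finset.coe_union, Set.mem_union, Finset.mem_coe] at hx ⊢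
  exact Or.inl (Or.inr hx)

/-- **Kirby's linear-independence scheme (axiom 4 over any finite set, in particular over the base
`ℚτ`)**: the generic exponential point of `W` has additive coordinates linearly independent over
`k₁ ⊇ ℚ(P ∪ {τ})`. [cite: Kirby2013Axioms, §2.3 (proof of the Proposition: the axiom scheme)] [cite: Kirby2013FPEF, §3] -/
theorem axiomFourScheme₂ :
    letI := expRing₂ A
    ∀ (n : ℕ) (W : Set (Fin n ⊕ Fin n → A.Ω)), IsIrreducibleClosed A.Ω W →
      (W ∩ torusLocus A.Ω n).Nonempty → IsRotund A.Ω n (W ∩ torusLocus A.Ω n) →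
      IsAddFree A.Ω n (W ∩ torusLocus A.Ω n) → IsMulFree A.Ω n (W ∩ torusLocus A.Ω n) →
      zariskiDim A.Ω W = n →
      ∀ P : Finset A.Ω, ∃ z ∈ W ∩ expGraph A.Ω n,
        ∀ m : Fin n → ℤ, (∑ i, (m i : A.Ω) * z (Sum.inl i)) ∈
          Submodule.span ℚ ({A.τ} ∪ ↑P : Set A.Ω) → m = 0 := by
  letI := expRing₂ A
  classical
  intro n W hirr hne hrot hadd hmul hdim P
  obtain ⟨G, rfl⟩ := exists_finset_W_eq hirr.1
  have hH : PState.Hyp G := ⟨hirr, hne, hrot, hadd, hmul, hdim⟩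
  obtain ⟨l, h, hz⟩ := exists_generic_expPt G P hH
  refine ⟨_, hz, fun m hm => (chain₂ A l).genPt_linIndep_k₁ h G P hH.irr hH.addFree m ?_⟩
  refine span_rat_le_subfield ?_ hm
  rintro x (rfl | hx)
  · refine (chain₂ A l).S₀_subset_k₁ h G P ?_
    simp only [PState.S₀, Finset.coe_union, Set.mem_union, Finset.mem_coe]
    exact Or.inl (Or.inl (Or.inl h.τ_mem))
  · refine (chain₂ A l).S₀_subset_k₁ h G P ?_
    simp only [PState.S₀, Finset.coe_union, Set.mem_union, Finset.mem_coe]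
    exact Or.inl (Or.inr hx)

/-! ### The countable pseudo-exponential field -/

/-- **A countable pseudo-exponential field** (Zilber 2005 §5; Kirby 2013, Thm 6.2 and Def. 6.3;
Bays–Kirby 2018, Thm 5.9): a countable algebraically closed exponential field of characteristic
zero with kernel `ℤτ`, `τ` transcendental, `ℚτ` strong (equivalently the Schanuel property),
surjective exponential, strongly exponentially-algebraically closed, satisfying Kirby's axiom-4
scheme over `ℚτ`, and of infinite `ecl`-dimension — realised inside `ℂ`.
[cite: Zilber2005PseudoExp, §5] [cite: Kirby2013FPEF, Thm 6.2 (proof)] [cite: BaysKirby2018ANT, Thm 5.9] -/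
theorem exists_countable_pseudoExpField :
    ∃ (M : Type) (_ : Field M) (_ : CharZero M)
      (_ : Literature.ModelTheory.ExponentialFields.ExponentialRing M) (τ : M),
      Countable M ∧ IsAlgClosed M ∧ IsSurjectiveOntoUnits M ∧ Transcendental ℚ τ ∧
      expKernel M = AddSubgroup.zmultiples τ ∧ IsStrong (Submodule.span ℚ ({τ} : Set M)) ∧
      SchanuelProperty M ∧ IsStronglyExpAlgClosed M ∧
      (∀ (n : ℕ) (W : Set (Fin n ⊕ Fin n → M)), IsIrreducibleClosed M W →
        (W ∩ torusLocus M n).Nonempty → IsRotund M n (W ∩ torusLocus M n) →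
        IsAddFree M n (W ∩ torusLocus M n) → IsMulFree M n (W ∩ torusLocus M n) →
        zariskiDim M W = n →
        ∀ P : Finset M, ∃ z ∈ W ∩ expGraph M n,
          ∀ m : Fin n → ℤ, (∑ i, (m i : M) * z (Sum.inl i)) ∈
            Submodule.span ℚ ({τ} ∪ ↑P : Set M) → m = 0) ∧
      ∀ C : Set M, C.Finite → ∃ d, d ∉ ecl C := by
  obtain ⟨A⟩ := AmbientData.nonempty
  letI := expRing₂ A
  exact ⟨A.Ω, inferInstance, inferInstance, expRing₂ A, A.τ, A.countable, A.isAlgClosed,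
    isSurjectiveOntoUnits₂, transcendental_τ, expKernel₂_eq, isStrong_span_τ₂, schanuelProperty₂,
    isStronglyExpAlgClosed₂, axiomFourScheme₂, exists_notMem_ecl₂⟩

end PseudoExpChain

end Literature.NumberTheory.Transcendental
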